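import Summits.QuantumFields.YangMills.Theorems.BalabanUVNodesN16AtRateRecord11
import Summits.QuantumFields.YangMills.Theorems.BalabanUVNodesRateCarriersOfRecord11
import HarnessLib

/-!
# Route «BalabanUVNodes», cluster K4 «SpineRates» — node N16 = NE3 AT THE RATE-RECORD HOME `RRec₁₁ 𝔯` BY NAME (layer B
# `BalabanUVNodesRateCarriersOfRecord11`, p457330): the K4 stub `S_N16 (RRec₁₁ 𝔯)` CLOSED IN ONE APPLICATION from the proviso `InEndRegime` and the print-form slot
# `PrintSlot` at the reading's NE3 bundles `ne3OfRecord₁₁ F ((𝔯.lit F θ g₀ os).ne3 k)`; the θ-sufficient form; N21's face at the home; and the junk tests AT THE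
# HOME — a reading with flat NE3 data has `S_N16 (RRec₁₁ 𝔯)` with no content, a reading with a negative-Lipschitz object has `¬ S_N16 (RRec₁₁ 𝔯)` as soon as a
# Stage-11 datum of record exists: the stub at the home is exactly as good as the PIN of `𝔯.lit · ne3`

Cell `pub-ymgap`, seat `pub-ymgap-dag-n16-e` (R134 acceleration seat (a), strategy s2 = BY-NAME KNIT at the ₁₁ record; HUMAN RULING D-0062; chair R424 venue),
generation 0, file 4 (THEOREMS ONLY, 0 `def`, 0 `sorry`).  `bears_on: R4∕N16 · K3 SpineGivenEndpointR11`.  Filed `--supports stmt-QuantumFields-19676`.  Imports this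
seat's file 3 `BalabanUVNodesN16AtRateRecord11` (p456710: everything at the LITERAL `⟨ne3LOfRecord₁₁ F, o.Nper, …, o.dom⟩`; through it files 1–2 p455532∕p455642:
`PrintSlot`, `InEndRegime`, `radiusOfRecord`, `constOfRecord`, `n16At_of_inEndRegime_printSlot`, the refuting carrier) and the RATE-RECORD HOME's LAYER B
(`BalabanUVNodesRateCarriersOfRecord11`, p457330, seat dag-n22-e, dag-lead WORDS-99∕101: `ne3OfRecord₁₁ F o` — DEFINED as that literal —, `RateReading₁₁ N`
(`lit : Node00.RateAssignment₁₁ N`, `ne1`), `rateCarriersOfRecord₁₁`, `RRec₁₁ 𝔯 := fun F D g₀ os R => ∃ (h : Node00.IsDatumOfRecord₁₁C F N D) (k : ℕ), R =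
rateCarriersOfRecord₁₁ 𝔯 F h.params g₀ os k`, the face `s_N16_rRec₁₁_iff`, the transfer `forall_datumKey_of_forall_admissible`).  Modifies nothing; cites by name.

CONTENT.
§1 AT THE HOME's NE3 BUNDLE `ne3OfRecord₁₁ F o` — `n16At_ne3OfRecord₁₁_iff` (`Iff.rfl` reading), `inEndRegime_ne3OfRecord₁₁_iff` (the proviso the pin displays:
«`1 ≤ o.Nper ∧ 0 < o.g ∧ 0 < o.ε ≤ radiusOfRecord N F.L o.Nper ∧ 0 ≤ o.Λ₁ ≤ radiusOfRecord N F.L o.Nper ∧ 0 ≤ o.b ≤ o.ε∕2 ∧ constOfRecord N F.L o.Nper o.g ≤ o.C`»),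
`n16At_ne3OfRecord₁₁_of_inEndRegime_printSlot` (one application).
§2 THE K4 STUB AT THE HOME — **`s_N16_rRec₁₁_of_inEndRegime_printSlot`**: `S_N16 (RRec₁₁ 𝔯)` from the proviso and the slot at every datum key, `(g₀, os)` and run
length (`s_N16_rRec₁₁_iff` + file 1's closer — THE KNIT of FAN-OUT §N16 s2 at the home of record); **`s_N16_rRec₁₁_of_forall_admissible`**: the θ-SUFFICIENT form a
prover of the pin discharges (proviso + slot at EVERY admissible `θ : Stage11Params F N` with provisos, along every `(g₀, os, k)`; transported to the canonical
parameter by layer B's `forall_datumKey_of_forall_admissible`).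
§3 N21's FACE AT THE HOME — `covRoot_rRec₁₁`: under `S_N16 (RRec₁₁ 𝔯)`, at every datum key and run length the covariant root `NE3EnergyRateWCov 4 (sfClass 4 L o.Nper
o.ε) L o.Nper o.b o.g o.C o.Λ₁ o.Λ₂' o.dom`, `L = ne3LOfRecord₁₁ F`, `o = (𝔯.lit F h.params g₀ os).ne3 k` (what `…N21ClosenessAtRecord` reads as `hcov`).
§4 THE JUNK TESTS AT THE HOME [decided toys] — `s_N16_rRec₁₁_of_flatReading` (a reading ALL of whose NE3 objects have period `≥ 1`, non-negative `ε, C, Λ₁, Λ₂'` and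
the FLAT STRATUM as data has `S_N16 (RRec₁₁ 𝔯)` — by `n16At_flatStratum`, no slot, no estimate); `not_s_N16_rRec₁₁_of_negLipReading` (a reading with a
`Λ₁ = −1` flat object at the canonical parameter of SOME datum of record has `¬ S_N16 (RRec₁₁ 𝔯)`); `exists_reading_ne3_const` (the reading type admits constant NE3
objects, any `o`); hence `exists_reading_s_N16_rRec₁₁` (SOME reading closes the stub outright) and `exists_reading_not_s_N16_rRec₁₁` (given `∃ F D, IsDatumOfRecord₁₁C
F N D` — the datum shadow of K0 `Record11Inhabited` — SOME reading refutes it).  R422 for N16 at the home, in the kernel: `S_N16 (RRec₁₁ 𝔯)` carries content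
exactly through the PIN of `𝔯.lit · ne3` — letters inside `InEndRegime` (THE END's thresholds, file 1; the radius reads the period `o.Nper`, which for the record's
unit lattice at run length `k` of the `K`-th approximation is `2·L^{m+K−k}` = `Setup.Params.sitesPerDir`, NOT fixed per family — the located volume tension of file
1's docstring) and `dom` = THE DATA THE TWO-RUN CONSUMERS COMPARE (the torus ↔ periodic-ℤ⁴ dictionary located in file 3's docstring).

HONEST FRAMING.  Kernel bookkeeping by name; no estimate; the proviso and the slot (`PrintSlot` = N05's [Balaban1985RegularSpaces] Theorem 4 at the record's pairs
+ N07's [Balaban1985Variational] Thm 1 (8)+(10)) are HYPOTHESES, proved nowhere in the tree; the reading `𝔯` is UNPINNED; `S_N16 (RRec₁₁ 𝔯)` is NOT proved for any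
reading of record; **N16 ∕ NE3 is NOT discharged**; count-neutral; one finite four-torus at fixed ε — NOT ℝ⁴, NOT infinite volume, NOT OS, NOT a mass gap, NOT Clay.
-/

set_option autoImplicit false

open scoped BigOperators Matrix Matrix.Norms.L2Operator
open NormedSpace

namespace Summit.QuantumFields.YangMills.BalabanUVNodes.N16AtRRec11

open Literature.MathematicalPhysics.QuantumFieldTheory.Balaban1983to89
open Literature.MathematicalPhysics.QuantumFieldTheory.Balaban1983to89.T4Continuum (T4Family ULoop FiniteEpsData)
open B7Prop1Explicit B7Prop2Explicit
open T4AveragingDeficitWallBoundary (IsPeriodicCfg)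
open Node00 (IsDatumOfRecord₁₁C Stage11Params NE3Objects₁₁ RateObjects₁₁ RateAssignment₁₁ ne3LOfRecord₁₁ two_le_ne3LOfRecord₁₁ nonempty_rateObjects₁₁
  datumOfRecord₁₁)
open Summit.QuantumFields.BalabanUV.T4Continuum
open MinimalActionRate (sfClass)
open MinimalActionRefine (gradConst)
open MinimalActionWitness (flatCfg)
open NE3EnergyShapes (IsUnitarySite)
open NE3EnergyWeightedCovShape (NE3EnergyRateWCov)
open NE1p.DressedRoot (growingTower)
open YMDAG.UVSplit (Datum NE3Carriers RateCarriers RateRecordPred N16At S_N16 ne3OfRecord₁₁ RateReading₁₁ rateCarriersOfRecord₁₁ RRec₁₁ s_N16_rRec₁₁_iff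
  forall_datumKey_of_forall_admissible)
open Summit.QuantumFields.YangMills.BalabanUVNodes.N16Regime (PrintSlot InEndRegime radiusOfRecord constOfRecord n16At_of_inEndRegime_printSlot)
open Summit.QuantumFields.YangMills.BalabanUVNodes.N16AtRateRecord11 (inEndRegime_ne3Objects_iff n16At_ne3Objects_flatDom not_n16At_ne3Objects_negLip
  exists_assignment_ne3_const)

noncomputable section

variable {N : ℕ} [NeZero N]

/-! ## §1 At the home's NE3 bundle `ne3OfRecord₁₁ F o` -/

omit [NeZero N] in
/-- **WHAT N16 SAYS AT THE HOME's NE3 BUNDLE** (`Iff.rfl`): `N16At (ne3OfRecord₁₁ F o)` IS the covariant root `NE3EnergyRateWCov 4 (sfClass 4 L o.Nper o.ε) L o.Nper o.b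
o.g o.C o.Λ₁ o.Λ₂' o.dom` with `L = ne3LOfRecord₁₁ F` (`= F.L`). [folklore] -/
theorem n16At_ne3OfRecord₁₁_iff (F : T4Family) (o : NE3Objects₁₁ N) :
    N16At (ne3OfRecord₁₁ F o) ↔
      NE3EnergyRateWCov 4 (sfClass 4 (ne3LOfRecord₁₁ F) o.Nper o.ε) (ne3LOfRecord₁₁ F) o.Nper o.b o.g o.C o.Λ₁ o.Λ₂' o.dom :=
  Iff.rfl

/-- **THE PROVISO AT THE HOME's NE3 BUNDLE** — `InEndRegime (ne3OfRecord₁₁ F o)` unfolded, the block-factor clause being the family's: what the PIN of `𝔯.lit · ne3`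
must DISPLAY (RR-2 PRE-READ §C item 2: exposed, never asserted). [folklore] -/
theorem inEndRegime_ne3OfRecord₁₁_iff (F : T4Family) (o : NE3Objects₁₁ N) :
    InEndRegime (ne3OfRecord₁₁ F o) ↔
      1 ≤ o.Nper ∧ 0 < o.g ∧ 0 < o.ε ∧ o.ε ≤ radiusOfRecord N F.L o.Nper ∧ 0 ≤ o.Λ₁ ∧ o.Λ₁ ≤ radiusOfRecord N F.L o.Nper ∧
        0 ≤ o.b ∧ o.b ≤ o.ε / 2 ∧ constOfRecord N F.L o.Nper o.g ≤ o.C :=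
  inEndRegime_ne3Objects_iff F o

/-- **N16 AT THE HOME's NE3 BUNDLE IN ONE APPLICATION** (file 1's closer). [folklore] -/
theorem n16At_ne3OfRecord₁₁_of_inEndRegime_printSlot (F : T4Family) (o : NE3Objects₁₁ N) (hreg : InEndRegime (ne3OfRecord₁₁ F o))
    (hslot : PrintSlot (ne3OfRecord₁₁ F o)) : N16At (ne3OfRecord₁₁ F o) :=
  n16At_of_inEndRegime_printSlot hreg hslot

/-! ## §2 The K4 stub at the home -/

/-- **THE KNIT AT THE HOME OF RECORD — `S_N16 (RRec₁₁ 𝔯)` FROM THE PROVISO AND THE SLOT AT EVERY BUNDLE OF THE READING**: for a rate reading `𝔯`, if at every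
datum of record (key `hD`, canonical parameter `hD.params`), every `(g₀, os)` and every run length `k` the NE3 bundle `ne3OfRecord₁₁ F ((𝔯.lit F hD.params g₀ os).ne3 k)`
satisfies `InEndRegime` (the pin's display) and carries `PrintSlot` (the pin's content: N05's Theorem 4 at the bundle's pairs + N07's `LeafH3sup`), then `S_N16 (RRec₁₁
𝔯)` — one application of layer B's `s_N16_rRec₁₁_iff` and file 1's closer.  Neither hypothesis is asserted here. [folklore] -/
theorem s_N16_rRec₁₁_of_inEndRegime_printSlot (𝔯 : RateReading₁₁ N)
    (h : ∀ (F : T4Family) (D : Datum F N) (hD : IsDatumOfRecord₁₁C F N D) (g₀ : ℕ → ℝ) (os : List (ULoop F)) (k : ℕ),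
      InEndRegime (ne3OfRecord₁₁ F ((𝔯.lit F hD.params g₀ os).ne3 k)) ∧ PrintSlot (ne3OfRecord₁₁ F ((𝔯.lit F hD.params g₀ os).ne3 k))) :
    S_N16 (RRec₁₁ 𝔯) :=
  (s_N16_rRec₁₁_iff 𝔯).2 fun F D hD g₀ os k => n16At_of_inEndRegime_printSlot (h F D hD g₀ os k).1 (h F D hD g₀ os k).2

/-- **THE θ-SUFFICIENT FORM OF THE KNIT** — what a prover of the pin discharges, with no canonical parameter in sight: the proviso and the slot at the reading's NE3
bundles for EVERY admissible `θ : Stage11Params F N` with provisos along every `(g₀, os, k)`; layer B's `forall_datumKey_of_forall_admissible` transports it to the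
datum keys. [folklore] -/
theorem s_N16_rRec₁₁_of_forall_admissible (𝔯 : RateReading₁₁ N)
    (h : ∀ (F : T4Family) (θ : Stage11Params F N), θ.Provisos₁₁ → θ.Admissible → ∀ (g₀ : ℕ → ℝ) (os : List (ULoop F)) (k : ℕ),
      InEndRegime (ne3OfRecord₁₁ F ((𝔯.lit F θ g₀ os).ne3 k)) ∧ PrintSlot (ne3OfRecord₁₁ F ((𝔯.lit F θ g₀ os).ne3 k))) :
    S_N16 (RRec₁₁ 𝔯) :=
  s_N16_rRec₁₁_of_inEndRegime_printSlot 𝔯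
    (forall_datumKey_of_forall_admissible
      (P := fun F _ θ g₀ os k => InEndRegime (ne3OfRecord₁₁ F ((𝔯.lit F θ g₀ os).ne3 k)) ∧ PrintSlot (ne3OfRecord₁₁ F ((𝔯.lit F θ g₀ os).ne3 k)))
      fun F θ hθ hA g₀ os k => h F θ hθ hA g₀ os k)

/-! ## §3 N21's face at the home -/

/-- **N21's FACE AT THE HOME OF RECORD** — under `S_N16 (RRec₁₁ 𝔯)`, at every datum key, `(g₀, os)` and run length the covariant root holds at the reading's NE3 objects
with the family's block factor (`…N21ClosenessAtRecord`'s `hcov` at the home; also `covRoot_at_record (h := ·) (rRec₁₁_self …)`). [folklore] -/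
theorem covRoot_rRec₁₁ (𝔯 : RateReading₁₁ N) (hS : S_N16 (RRec₁₁ 𝔯)) (F : T4Family) (D : Datum F N) (hD : IsDatumOfRecord₁₁C F N D) (g₀ : ℕ → ℝ)
    (os : List (ULoop F)) (k : ℕ) :
    NE3EnergyRateWCov 4 (sfClass 4 (ne3LOfRecord₁₁ F) ((𝔯.lit F hD.params g₀ os).ne3 k).Nper ((𝔯.lit F hD.params g₀ os).ne3 k).ε) (ne3LOfRecord₁₁ F)
      ((𝔯.lit F hD.params g₀ os).ne3 k).Nper ((𝔯.lit F hD.params g₀ os).ne3 k).b ((𝔯.lit F hD.params g₀ os).ne3 k).g ((𝔯.lit F hD.params g₀ os).ne3 k).C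
      ((𝔯.lit F hD.params g₀ os).ne3 k).Λ₁ ((𝔯.lit F hD.params g₀ os).ne3 k).Λ₂' ((𝔯.lit F hD.params g₀ os).ne3 k).dom :=
  (s_N16_rRec₁₁_iff 𝔯).1 hS F D hD g₀ os k

/-! ## §4 The junk tests at the home: the pin of `𝔯.lit · ne3` decides -/

/-- **A READING WITH FLAT NE3 DATA HAS `S_N16 (RRec₁₁ 𝔯)` — CONTENT-FREE** [decided toy]: if every NE3 object of the reading (all families, admissible parameters,
`(g₀, os)`, run lengths) has period `≥ 1`, non-negative `ε, C, Λ₁, Λ₂'` and the flat stratum of its period as data, the stub at the home holds by n16-a's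
`n16At_flatStratum` — no slot, no estimate.  So the `dom` pin is where N16's content enters the home. [folklore] -/
theorem s_N16_rRec₁₁_of_flatReading (𝔯 : RateReading₁₁ N)
    (hflat : ∀ (F : T4Family) (θ : Stage11Params F N) (g₀ : ℕ → ℝ) (os : List (ULoop F)) (k : ℕ),
      1 ≤ ((𝔯.lit F θ g₀ os).ne3 k).Nper ∧ 0 ≤ ((𝔯.lit F θ g₀ os).ne3 k).ε ∧ 0 ≤ ((𝔯.lit F θ g₀ os).ne3 k).C ∧ 0 ≤ ((𝔯.lit F θ g₀ os).ne3 k).Λ₁ ∧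
        0 ≤ ((𝔯.lit F θ g₀ os).ne3 k).Λ₂' ∧
        ((𝔯.lit F θ g₀ os).ne3 k).dom = {v : Site 4 → Fin 4 → (Matrix (Fin N) (Fin N) ℂ)ˣ | IsPeriodicCfg v (((𝔯.lit F θ g₀ os).ne3 k).Nper : ℤ) ∧
          ∃ w : Site 4 → (Matrix (Fin N) (Fin N) ℂ)ˣ, IsUnitarySite w ∧ v = gaugeAct w flatCfg}) :
    S_N16 (RRec₁₁ 𝔯) := by
  refine (s_N16_rRec₁₁_iff 𝔯).2 fun F D hD g₀ os k => ?_
  obtain ⟨hN, hε, hC, hΛ₁, hΛ₂', hdom⟩ := hflat F hD.params g₀ os k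
  exact n16At_ne3Objects_flatDom F _ hN hε hC hΛ₁ hΛ₂' hdom

/-- **A READING WITH A NEGATIVE-LIPSCHITZ OBJECT AT SOME DATUM OF RECORD HAS NO `S_N16 (RRec₁₁ 𝔯)`** [decided toy]: if at the canonical parameter of some datum of
record, some `(g₀, os, k)`, the reading's NE3 object has `Λ₁ = −1`, `g = gradConst 4 c′`, `ε, b, c′ ≥ 0` and flat data, the stub at the home FAILS (file 2's refuting
carrier) — letters left free in the reading are refuted; the pin owes `InEndRegime`. [folklore] -/
theorem not_s_N16_rRec₁₁_of_negLipReading (𝔯 : RateReading₁₁ N) {F : T4Family} {D : Datum F N} (hD : IsDatumOfRecord₁₁C F N D) (g₀ : ℕ → ℝ)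
    (os : List (ULoop F)) (k : ℕ) {c' : ℝ} (hε : 0 ≤ ((𝔯.lit F hD.params g₀ os).ne3 k).ε) (hb : 0 ≤ ((𝔯.lit F hD.params g₀ os).ne3 k).b) (hc' : 0 ≤ c')
    (hg : ((𝔯.lit F hD.params g₀ os).ne3 k).g = gradConst 4 c') (hΛ₁ : ((𝔯.lit F hD.params g₀ os).ne3 k).Λ₁ = -1)
    (hdom : ((𝔯.lit F hD.params g₀ os).ne3 k).dom = {v : Site 4 → Fin 4 → (Matrix (Fin N) (Fin N) ℂ)ˣ |
      IsPeriodicCfg v (((𝔯.lit F hD.params g₀ os).ne3 k).Nper : ℤ) ∧ ∃ w : Site 4 → (Matrix (Fin N) (Fin N) ℂ)ˣ, IsUnitarySite w ∧ v = gaugeAct w flatCfg}) :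
    ¬ S_N16 (RRec₁₁ 𝔯) := fun hS =>
  not_n16At_ne3Objects_negLip F ((𝔯.lit F hD.params g₀ os).ne3 k) hε hb hc' hg hΛ₁ hdom ((s_N16_rRec₁₁_iff 𝔯).1 hS F D hD g₀ os k)

/-- **THE READING TYPE ADMITS CONSTANT NE3 OBJECTS** (any `o`; U3 ∕ NE2 components from RR-1's `nonempty_rateObjects₁₁`, the dressed-tower component the doubling
toy `growingTower`) — so both junk tests bite. [folklore] -/
theorem exists_reading_ne3_const (o : NE3Objects₁₁ N) :
    ∃ 𝔯 : RateReading₁₁ N, ∀ (F : T4Family) (θ : Stage11Params F N) (g₀ : ℕ → ℝ) (os : List (ULoop F)) (k : ℕ), (𝔯.lit F θ g₀ os).ne3 k = o := by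
  obtain ⟨lit, hlit⟩ := exists_assignment_ne3_const (N := N) o
  exact ⟨⟨lit, fun _ _ _ _ => ⟨Unit, growingTower, 1⟩⟩, hlit⟩

/-- **SOME READING CLOSES THE STUB AT THE HOME OUTRIGHT** [decided toy]: the constant reading at the flat object of period `1` with zero letters. [folklore] -/
theorem exists_reading_s_N16_rRec₁₁ : ∃ 𝔯 : RateReading₁₁ N, S_N16 (RRec₁₁ 𝔯) := by
  obtain ⟨𝔯, h𝔯⟩ := exists_reading_ne3_const (N := N)
    ⟨1, 0, 0, 0, 0, 0, 0, {v : Site 4 → Fin 4 → (Matrix (Fin N) (Fin N) ℂ)ˣ | IsPeriodicCfg v ((1 : ℕ) : ℤ) ∧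
      ∃ w : Site 4 → (Matrix (Fin N) (Fin N) ℂ)ˣ, IsUnitarySite w ∧ v = gaugeAct w flatCfg}⟩
  refine ⟨𝔯, s_N16_rRec₁₁_of_flatReading 𝔯 fun F θ g₀ os k => ?_⟩
  rw [h𝔯 F θ g₀ os k]
  exact ⟨le_rfl, le_rfl, le_rfl, le_rfl, le_rfl, rfl⟩

/-- **GIVEN A DATUM OF RECORD, SOME READING REFUTES THE STUB AT THE HOME** [decided toy] (the hypothesis is the datum shadow of K0 `Record11Inhabited` at rank `N`:
`Node00.isDatumOfRecord₁₁C_iff_exists_world`): the constant reading at the `Λ₁ = −1` flat object. [folklore] -/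
theorem exists_reading_not_s_N16_rRec₁₁ (hex : ∃ (F : T4Family) (D : Datum F N), IsDatumOfRecord₁₁C F N D) :
    ∃ 𝔯 : RateReading₁₁ N, ¬ S_N16 (RRec₁₁ 𝔯) := by
  obtain ⟨F, D, hD⟩ := hex
  obtain ⟨𝔯, h𝔯⟩ := exists_reading_ne3_const (N := N)
    ⟨1, 0, 0, gradConst 4 0, 0, -1, 0, {v : Site 4 → Fin 4 → (Matrix (Fin N) (Fin N) ℂ)ˣ | IsPeriodicCfg v ((1 : ℕ) : ℤ) ∧
      ∃ w : Site 4 → (Matrix (Fin N) (Fin N) ℂ)ˣ, IsUnitarySite w ∧ v = gaugeAct w flatCfg}⟩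
  have ho := h𝔯 F hD.params (fun _ => 0) [] 0
  refine ⟨𝔯, not_s_N16_rRec₁₁_of_negLipReading 𝔯 hD (fun _ => 0) [] 0 (c' := 0) ?_ ?_ le_rfl ?_ ?_ ?_⟩
  · rw [ho]
  · rw [ho]
  · rw [ho]
  · rw [ho]
  · rw [ho]

end

end Summit.QuantumFields.YangMills.BalabanUVNodes.N16AtRRec11
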